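import Mathlib
import HarnessLib
import Summits.HubbardSuperconductivity.HubbardSuperconductivity.Theorems.KLProgrammeKLRegimeTwoVolumeDataKitWt
import Summits.HubbardSuperconductivity.HubbardSuperconductivity.Theorems.KLProgrammeKLRegimeTwoVolumeDeepPinGeometry
import Summits.HubbardSuperconductivity.HubbardSuperconductivity.Theorems.KLProgrammeKLRegimeTwoVolumeBlockCovariance
import Summits.HubbardSuperconductivity.HubbardSuperconductivity.Theorems.KLProgrammeKLRegimeTwoVolumeGridCounterGluingWt

/-!
# Route `KLProgramme` — crux K3, VL child `KLRegimeVolumeLimitV17F2` (stmt-HubbardSuperconductivity-20440), blueprint v5 M3b kit, part 2: THE TRANSFER DATA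
# OF THE Λ-SCALED TWO-VOLUME STEP FROM TWO SCALED WEIGHTED SUMS (seat hubbard-kl-k3c4-p1 g12; `--supports` 20440)

`…TwoVolumeSrcSectorScaleSuccWt.srcSector_sum_norm_kernel_twoVolume_scaleSucc_wt_le` (M3d-wt) reads NINE data of the fine block substitution `T = T⁺_{L″}` (column
sums `hcolT`, box-collapsed columns `hwinT`, in-block rows `hρT`, near rows `hrowFT`, far tails `hτFT`, other-block column tails `hτ₁T`, other-block row tails `hτ₂T`,
far in-block rows `hτ₃T`, winding tails `hτ₄T`).  For a substitution whose rows AND columns are summable with the scaled weight `1 + Λ_T·tnorm(site x − site y′)`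
(`≤ cW`; the engine's weighted overlap rows/cols of `E(F_j)·S(F̃_{j−1})`, `…SectorMultiplierOverlapWt…`, dominate them — `…TwoVolumeDataKitWt`) and which is
BLOCK COVARIANT (`…TwoVolumeSectorBlockShift.sectorOverlap_blockCovariant`), all nine follow with `aT := cW` and `τT := cW/(1 + Λ_T(r+1))` for every deep-pin
region schedule `r ≤ RN`, `r ≤ RF`, `r + RZ ≤ R` (`R` the zone depth).  Generic in the leg types: fine out-legs `Γ′ ≃ ι × Γ`, fine in-legs `Γ₁′ ≃ ι × Γ₁`
(`ι = Fin 2 → Fin b`), with site maps, block index `⌊site/L⌋` and residue sites.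

* §1 box sums: `sum_coarse_eq_sum_box`, `sum_erase_blocks_eq_sum_filter_ne`, `sum_box_le_sum`;
* §2 geometry: `deep_of_sameBlock_near` (the in-block leg near a deep leg is deep), `far_of_block_ne_of_deep` (other blocks are far from a deep leg);
* §3 the nine data: `transfer_col_le`, `transfer_win_le`, `transfer_rho_le`, `transfer_rowF_le`, `transfer_tauF_le`, `transfer_tau2_le`, `transfer_tau3_le`,
  `transfer_tau1_le`, `transfer_tau4_le`.

Pure bookkeeping; proofs only; no definition.  Reference for the role: BGM 2006 §3 (3.2)–(3.8).
-/

noncomputable section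

namespace Summit.HubbardSuperconductivity.HubbardSuperconductivity.Theorems.TwoVolumeDefect

set_option linter.dupNamespace false -- summit = problem name (single-conjunct summit), D-0017

open Finset Literature.MathematicalPhysics.QuantumLattice GrassmannAlgebra Literature.Probability.LatticeModels

/-! ## §1 Box sums and tails of rectangular kernels -/

section Boxes

/-- **A sum over the coarse labels of a box is the sum over the box.** [folklore] -/
theorem sum_coarse_eq_sum_box {ι Γ₁ Γ₁' : Type*} [Fintype Γ₁] [Fintype Γ₁'] [DecidableEq ι] (e₁ : Γ₁' ≃ ι × Γ₁) (β : ι) (f : Γ₁' → ℝ) :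
    ∑ y : Γ₁, f (e₁.symm (β, y)) = ∑ y' ∈ univ.filter (fun y' : Γ₁' => (e₁ y').1 = β), f y' :=
  (sum_box_eq_sum_coarse e₁ β f).symm

/-- **The boxes other than `β₀` tile the complement of box `β₀`.** [folklore] -/
theorem sum_erase_blocks_eq_sum_filter_ne {ι Γ₁ Γ₁' : Type*} [Fintype ι] [DecidableEq ι] [Fintype Γ₁] [Fintype Γ₁'] (e₁ : Γ₁' ≃ ι × Γ₁) (β₀ : ι)
    (f : Γ₁' → ℝ) :
    ∑ β ∈ univ.erase β₀, ∑ y : Γ₁, f (e₁.symm (β, y)) = ∑ y' ∈ univ.filter (fun y' : Γ₁' => (e₁ y').1 ≠ β₀), f y' := by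
  classical
  simp_rw [sum_coarse_eq_sum_box e₁]
  rw [← sum_biUnion]
  · refine sum_congr ?_ fun _ _ => rfl
    ext y'
    simp only [mem_biUnion, mem_erase, mem_univ, mem_filter, true_and, and_true, ne_eq]
    constructor
    · rintro ⟨β, hβ, hy⟩; rw [hy]; exact hβ
    · intro h; exact ⟨_, h, rfl⟩
  · intro β _ β' _ hne
    simp only [Function.onFun]
    rw [disjoint_filter]
    intro y' _ h1 h2; exact hne (h1.symm.trans h2)

/-- **A box sum of nonnegative terms is at most the full sum.** [folklore] -/
theorem sum_box_le_sum {ι Γ₁ Γ₁' : Type*} [Fintype Γ₁] [Fintype Γ₁'] [DecidableEq ι] (e₁ : Γ₁' ≃ ι × Γ₁) (β : ι) (f : Γ₁' → ℝ) (hf : ∀ y', 0 ≤ f y') :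
    ∑ y : Γ₁, f (e₁.symm (β, y)) ≤ ∑ y', f y' := by
  rw [sum_coarse_eq_sum_box e₁ β f]
  exact sum_le_sum_of_subset_of_nonneg (filter_subset _ _) fun y' _ _ => hf y'

/-- **The far row tail of a rectangular kernel** with two site maps: `Σ_{Y : R < tnorm(sa X − sb Y)} ‖A X Y‖ ≤ αw/(1 + Λ(R+1))`. [folklore] -/
theorem sum_far_norm_le_of_scaledRow₂ {Γa Γb : Type*} [Fintype Γb] {V : ℕ} (sa : Γa → TorusSite 2 V) (sb : Γb → TorusSite 2 V) (A : Matrix Γa Γb ℂ)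
    {Λ' : ℝ} (hΛ' : 0 ≤ Λ') (R' : ℕ) {αw : ℝ} (X : Γa) (h : ∑ Y, ‖A X Y‖ * (1 + Λ' * (Torus.tnorm (sa X - sb Y) : ℝ)) ≤ αw) :
    ∑ Y ∈ univ.filter (fun Y => R' < Torus.tnorm (sa X - sb Y)), ‖A X Y‖ ≤ αw / (1 + Λ' * ((R' : ℝ) + 1)) := by
  have h' := sum_filter_lt_le_inv_mul_sum_scaled univ (fun Y => ‖A X Y‖) (fun Y => Torus.tnorm (sa X - sb Y)) (fun _ _ => norm_nonneg _) hΛ' R'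
  rw [div_eq_inv_mul]
  exact h'.trans (mul_le_mul_of_nonneg_left h (inv_nonneg.2 (by positivity)))

/-- **The far column tail of a rectangular kernel.** [folklore] -/
theorem sum_far_norm_le_of_scaledCol₂ {Γa Γb : Type*} [Fintype Γa] {V : ℕ} (sa : Γa → TorusSite 2 V) (sb : Γb → TorusSite 2 V) (A : Matrix Γa Γb ℂ)
    {Λ' : ℝ} (hΛ' : 0 ≤ Λ') (R' : ℕ) {αw : ℝ} (Y : Γb) (h : ∑ X, ‖A X Y‖ * (1 + Λ' * (Torus.tnorm (sa X - sb Y) : ℝ)) ≤ αw) :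
    ∑ X ∈ univ.filter (fun X => R' < Torus.tnorm (sa X - sb Y)), ‖A X Y‖ ≤ αw / (1 + Λ' * ((R' : ℝ) + 1)) := by
  have h' := sum_filter_lt_le_inv_mul_sum_scaled univ (fun X => ‖A X Y‖) (fun X => Torus.tnorm (sa X - sb Y)) (fun _ _ => norm_nonneg _) hΛ' R'
  rw [div_eq_inv_mul]
  exact h'.trans (mul_le_mul_of_nonneg_left h (inv_nonneg.2 (by positivity)))

/-- A tail bound at radius `R` is a tail bound at every `r ≤ R`. [folklore] -/
theorem div_one_add_mul_anti {c Λ' : ℝ} (hc : 0 ≤ c) (hΛ' : 0 ≤ Λ') {r R : ℕ} (h : r ≤ R) :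
    c / (1 + Λ' * ((R : ℝ) + 1)) ≤ c / (1 + Λ' * ((r : ℝ) + 1)) := by
  have : (r : ℝ) ≤ R := by exact_mod_cast h
  exact div_le_div_of_nonneg_left hc (by positivity) (by nlinarith)

/-- `tnorm (y − x) ≤ tnorm (x − y)` (hence equality; the centred representative of `−u` has the same sup norm). [folklore] -/
theorem tnorm_sub_comm_le {V : ℕ} [NeZero V] (x y : TorusSite 2 V) : Torus.tnorm (y - x) ≤ Torus.tnorm (x - y) := by
  rw [← neg_sub]; exact Torus.tnorm_neg_le _

end Boxes

/-! ## §2 Geometry: the in-block leg near a deep leg is deep; other blocks are far from a deep leg -/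

section Geometry

/-- **The in-block leg at a residue near a deep leg is deep.**  If `x` is `R`-deep (residues in `[R, L−R)`), the residue site of `y″` is within `RZ` of the
residue site of `x`, and `r + RZ ≤ R`, then `y″` is `r`-deep. [folklore] -/
theorem deep_of_sameBlock_near {L Lf : ℕ} [NeZero L] {R RZ r : ℕ} (hr : r + RZ ≤ R) {sx sy : TorusSite 2 Lf}
    (hx : ∀ j, R ≤ (sx j).val % L ∧ (sx j).val % L + R < L)
    (hnear : Torus.tnorm ((fun i => ((((sx i).val : ℕ)) : ZMod L)) - fun i => ((((sy i).val : ℕ)) : ZMod L)) ≤ RZ) :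
    ∀ j, r ≤ (sy j).val % L ∧ (sy j).val % L + r < L := by
  have hval : ∀ (s : TorusSite 2 Lf) (j : Fin 2), ((fun i => ((((s i).val : ℕ)) : ZMod L)) j).val = (s j).val % L :=
    fun s j => by simp only [ZMod.val_natCast]
  have hw : ∀ j, (R - RZ) + RZ ≤ ((fun i => ((((sx i).val : ℕ)) : ZMod L)) j).val ∧
      ((fun i => ((((sx i).val : ℕ)) : ZMod L)) j).val + ((R - RZ) + RZ) < L := by
    intro j; rw [hval, Nat.sub_add_cancel (by omega)]; exact hx j
  have hnear' : Torus.tnorm ((fun i => ((((sy i).val : ℕ)) : ZMod L)) - fun i => ((((sx i).val : ℕ)) : ZMod L)) ≤ RZ :=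
    (tnorm_sub_comm_le _ _).trans hnear
  have h := deep_of_near_of_deep hw hnear'
  intro j
  have hj := h j
  rw [hval] at hj
  omega

/-- **Other blocks are far from a deep leg**: if `⌊site x₂/L⌋ ≠ ⌊site y″/L⌋` (as block vectors) and `y″` is `r`-deep then `r < tnorm (site x₂ − site y″)`. [folklore] -/
theorem far_of_block_ne_of_deep {b L Lf : ℕ} [NeZero Lf] (hLf : Lf = b * L) {r : ℕ} {s₂ sy : TorusSite 2 Lf} {β₂ βy : Fin 2 → Fin b}
    (h₂ : ∀ i, ((β₂ i : ℕ)) = (s₂ i).val / L) (hy : ∀ i, ((βy i : ℕ)) = (sy i).val / L) (hne : β₂ ≠ βy)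
    (hdeep : ∀ j, r ≤ (sy j).val % L ∧ (sy j).val % L + r < L) : r < Torus.tnorm (s₂ - sy) := by
  obtain ⟨i, hi⟩ : ∃ i, β₂ i ≠ βy i := by by_contra h; push Not at h; exact hne (funext h)
  have hblk : (s₂ i).val / L ≠ (sy i).val / L := by
    intro h; apply hi; apply Fin.ext; rw [h₂ i, hy i, h]
  exact tnorm_sub_gt_of_block_ne (d := 2) hLf hblk (Or.inr hdeep)

end Geometry

/-! ## §3 The nine transfer data of the Λ-scaled step -/

section Transfer

/-- `hcolT`: the plain column sums are `≤ cW`. [folklore] -/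
theorem transfer_col_le {Γ' Γ₁' : Type*} [Fintype Γ'] [Fintype Γ₁'] {Lf : ℕ} (site' : Γ' → TorusSite 2 Lf) (site₁ : Γ₁' → TorusSite 2 Lf)
    (T : Matrix Γ' Γ₁' ℂ) {ΛT cW : ℝ} (hΛT : 0 ≤ ΛT)
    (hcol : ∀ y', ∑ x, ‖T x y'‖ * (1 + ΛT * (Torus.tnorm (site' x - site₁ y') : ℝ)) ≤ cW) (y' : Γ₁') : ∑ x, ‖T x y'‖ ≤ cW :=
  (sum_le_sum fun x _ => le_mul_of_one_le_right (norm_nonneg _)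
    (by nlinarith [hΛT, (Nat.cast_nonneg (Torus.tnorm (site' x - site₁ y')) : (0:ℝ) ≤ _)])).trans (hcol y')

/-- `hwinT`: under BLOCK COVARIANCE the box-collapsed column sums ARE column sums, hence `≤ cW`. [folklore] -/
theorem transfer_win_le {Γ' Γ₁' : Type*} [Fintype Γ'] [Fintype Γ₁'] {Lf : ℕ} (site' : Γ' → TorusSite 2 Lf) (site₁ : Γ₁' → TorusSite 2 Lf)
    (T : Matrix Γ' Γ₁' ℂ) {ΛT cW : ℝ} (hΛT : 0 ≤ ΛT)
    (hcol : ∀ y', ∑ x, ‖T x y'‖ * (1 + ΛT * (Torus.tnorm (site' x - site₁ y') : ℝ)) ≤ cW)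
    {b : ℕ} [NeZero b] {Γ Γ₁ : Type*} [Fintype Γ] [Fintype Γ₁] (ed : Γ' ≃ (Fin 2 → Fin b) × Γ) (ed₁ : Γ₁' ≃ (Fin 2 → Fin b) × Γ₁)
    (hcov : ∀ (δ β' β : Fin 2 → Fin b) (xbar : Γ) (y : Γ₁), ‖T (ed.symm (β' + δ, xbar)) (ed₁.symm (β + δ, y))‖ = ‖T (ed.symm (β', xbar)) (ed₁.symm (β, y))‖)
    (β' : Fin 2 → Fin b) (y : Γ₁) : ∑ β, ∑ x ∈ univ.filter (fun x : Γ' => (ed x).1 = β'), ‖T x (ed₁.symm (β, y))‖ ≤ cW := by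
  classical
  rw [sum_blocks_sum_box_eq_colSum ed₁ ed (fun x y' => ‖T x y'‖) hcov β' β' y]
  exact transfer_col_le site' site₁ T hΛT hcol _

/-- `hρT`: the in-block row sums are `≤ cW`. [folklore] -/
theorem transfer_rho_le {Γ' Γ₁' : Type*} [Fintype Γ'] [Fintype Γ₁'] {Lf : ℕ} (site' : Γ' → TorusSite 2 Lf) (site₁ : Γ₁' → TorusSite 2 Lf)
    (T : Matrix Γ' Γ₁' ℂ) {ΛT cW : ℝ} (hΛT : 0 ≤ ΛT)
    (hrow : ∀ x, ∑ y', ‖T x y'‖ * (1 + ΛT * (Torus.tnorm (site' x - site₁ y') : ℝ)) ≤ cW)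
    {b : ℕ} {Γ Γ₁ : Type*} [Fintype Γ₁] (ed : Γ' ≃ (Fin 2 → Fin b) × Γ) (ed₁ : Γ₁' ≃ (Fin 2 → Fin b) × Γ₁) (x : Γ') :
    ∑ y, ‖T x (ed₁.symm ((ed x).1, y))‖ ≤ cW := by
  classical
  exact (sum_box_le_sum ed₁ (ed x).1 (fun y' => ‖T x y'‖) fun _ => norm_nonneg _).trans
    (sum_norm_le_of_scaledRow T (fun x y' => 1 + ΛT * (Torus.tnorm (site' x - site₁ y') : ℝ))
      (fun x y' => by nlinarith [hΛT, (Nat.cast_nonneg (Torus.tnorm (site' x - site₁ y')) : (0:ℝ) ≤ _)]) x (hrow x))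

/-- `hrowFT`: the near row sums are `≤ cW`. [folklore] -/
theorem transfer_rowF_le {Γ' Γ₁' : Type*} [Fintype Γ'] [Fintype Γ₁'] {Lf : ℕ} (site' : Γ' → TorusSite 2 Lf) (site₁ : Γ₁' → TorusSite 2 Lf)
    (T : Matrix Γ' Γ₁' ℂ) {ΛT cW : ℝ} (hΛT : 0 ≤ ΛT)
    (hrow : ∀ x, ∑ y', ‖T x y'‖ * (1 + ΛT * (Torus.tnorm (site' x - site₁ y') : ℝ)) ≤ cW) (RF : ℕ) (x : Γ') :
    ∑ y' ∈ univ.filter (fun y' : Γ₁' => Torus.tnorm (site' x - site₁ y') ≤ RF), ‖T x y'‖ ≤ cW :=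
  (sum_le_sum_of_subset_of_nonneg (filter_subset _ _) fun _ _ _ => norm_nonneg _).trans
    (sum_norm_le_of_scaledRow T (fun x y' => 1 + ΛT * (Torus.tnorm (site' x - site₁ y') : ℝ))
      (fun x y' => by nlinarith [hΛT, (Nat.cast_nonneg (Torus.tnorm (site' x - site₁ y')) : (0:ℝ) ≤ _)]) x (hrow x))

/-- `hτFT`: the far row tails are `≤ cW/(1 + Λ_T(r+1))` for `r ≤ RF`. [folklore] -/
theorem transfer_tauF_le {Γ' Γ₁' : Type*} [Fintype Γ'] [Fintype Γ₁'] {Lf : ℕ} (site' : Γ' → TorusSite 2 Lf) (site₁ : Γ₁' → TorusSite 2 Lf)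
    (T : Matrix Γ' Γ₁' ℂ) {ΛT cW : ℝ} (hΛT : 0 ≤ ΛT)
    (hrow : ∀ x, ∑ y', ‖T x y'‖ * (1 + ΛT * (Torus.tnorm (site' x - site₁ y') : ℝ)) ≤ cW) (hcW : 0 ≤ cW) {r RF : ℕ} (hrF : r ≤ RF) (x : Γ') :
    ∑ y' ∈ univ.filter (fun y' : Γ₁' => ¬ Torus.tnorm (site' x - site₁ y') ≤ RF), ‖T x y'‖ ≤ cW / (1 + ΛT * ((r : ℝ) + 1)) := by
  have hs : univ.filter (fun y' : Γ₁' => ¬ Torus.tnorm (site' x - site₁ y') ≤ RF) = univ.filter (fun y' : Γ₁' => RF < Torus.tnorm (site' x - site₁ y')) :=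
    filter_congr fun _ _ => by simp only [not_le]
  rw [hs]
  exact (sum_far_norm_le_of_scaledRow₂ site' site₁ T hΛT RF x (hrow x)).trans (div_one_add_mul_anti hcW hΛT hrF)

/-- `hτ₂T`: at an `R`-deep out-leg the rows over the OTHER blocks are `≤ cW/(1 + Λ_T(r+1))` (`r ≤ R`). [folklore] -/
theorem transfer_tau2_le {Γ' Γ₁' : Type*} [Fintype Γ'] [Fintype Γ₁'] {Lf : ℕ} (site' : Γ' → TorusSite 2 Lf) (site₁ : Γ₁' → TorusSite 2 Lf)
    (T : Matrix Γ' Γ₁' ℂ) {ΛT cW : ℝ} (hΛT : 0 ≤ ΛT)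
    (hrow : ∀ x, ∑ y', ‖T x y'‖ * (1 + ΛT * (Torus.tnorm (site' x - site₁ y') : ℝ)) ≤ cW) (hcW : 0 ≤ cW)
    {b L : ℕ} [NeZero L] [NeZero Lf] [NeZero b] (hLf : Lf = b * L) {Γ Γ₁ : Type*} [Fintype Γ] [Fintype Γ₁]
    (ed : Γ' ≃ (Fin 2 → Fin b) × Γ) (ed₁ : Γ₁' ≃ (Fin 2 → Fin b) × Γ₁)
    (hed1 : ∀ x i, (((ed x).1 i : ℕ)) = (site' x i).val / L) (hed₁1 : ∀ y' i, (((ed₁ y').1 i : ℕ)) = (site₁ y' i).val / L)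
    {r R : ℕ} (hrR : r ≤ R) (x : Γ') (hx : ∀ j, R ≤ (site' x j).val % L ∧ (site' x j).val % L + R < L) :
    ∑ β ∈ univ.erase (ed x).1, ∑ y, ‖T x (ed₁.symm (β, y))‖ ≤ cW / (1 + ΛT * ((r : ℝ) + 1)) := by
  classical
  rw [sum_erase_blocks_eq_sum_filter_ne ed₁ (ed x).1 (fun y' => ‖T x y'‖)]
  have hfar : ∀ y' : Γ₁', (ed₁ y').1 ≠ (ed x).1 → R < Torus.tnorm (site' x - site₁ y') := fun y' hne =>
    lt_of_lt_of_le (far_of_block_ne_of_deep hLf (hed₁1 y') (hed1 x) hne hx) (tnorm_sub_comm_le _ _)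
  calc ∑ y' ∈ univ.filter (fun y' : Γ₁' => (ed₁ y').1 ≠ (ed x).1), ‖T x y'‖
      ≤ ∑ y' ∈ univ.filter (fun y' : Γ₁' => R < Torus.tnorm (site' x - site₁ y')), ‖T x y'‖ :=
        sum_le_sum_of_subset_of_nonneg (fun y' hy => by
          simp only [mem_filter, mem_univ, true_and] at hy ⊢; exact hfar y' hy) fun _ _ _ => norm_nonneg _
    _ ≤ cW / (1 + ΛT * ((R : ℝ) + 1)) := sum_far_norm_le_of_scaledRow₂ site' site₁ T hΛT R x (hrow x)
    _ ≤ cW / (1 + ΛT * ((r : ℝ) + 1)) := div_one_add_mul_anti hcW hΛT hrR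

/-- `hτ₃T`: at any out-leg, the in-block rows over residues FAR from the out-leg's residue (`> RN`) are `≤ cW/(1 + Λ_T(r+1))` (`r ≤ RN`; residue
distance ≤ fine distance, `L ∣ L″`). [folklore] -/
theorem transfer_tau3_le {Γ' Γ₁' : Type*} [Fintype Γ'] [Fintype Γ₁'] {Lf : ℕ} (site' : Γ' → TorusSite 2 Lf) (site₁ : Γ₁' → TorusSite 2 Lf)
    (T : Matrix Γ' Γ₁' ℂ) {ΛT cW : ℝ} (hΛT : 0 ≤ ΛT)
    (hrow : ∀ x, ∑ y', ‖T x y'‖ * (1 + ΛT * (Torus.tnorm (site' x - site₁ y') : ℝ)) ≤ cW) (hcW : 0 ≤ cW)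
    {b L : ℕ} [NeZero L] [NeZero Lf] [NeZero b] (hLf : Lf = b * L) {Γ Γ₁ : Type*} [Fintype Γ] [Fintype Γ₁]
    (ed : Γ' ≃ (Fin 2 → Fin b) × Γ) (ed₁ : Γ₁' ≃ (Fin 2 → Fin b) × Γ₁)
    (csite : Γ → TorusSite 2 L) (csite₁ : Γ₁ → TorusSite 2 L)
    (hed2 : ∀ x, csite (ed x).2 = fun i => ((((site' x i).val : ℕ)) : ZMod L)) (hed₁2 : ∀ y', csite₁ (ed₁ y').2 = fun i => ((((site₁ y' i).val : ℕ)) : ZMod L))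
    {r RN : ℕ} (hrN : r ≤ RN) (x : Γ') :
    ∑ y ∈ univ.filter (fun y : Γ₁ => ¬ Torus.tnorm (csite (ed x).2 - csite₁ y) ≤ RN), ‖T x (ed₁.symm ((ed x).1, y))‖ ≤ cW / (1 + ΛT * ((r : ℝ) + 1)) := by
  classical
  have h2 := sum_coarse_eq_sum_box ed₁ (ed x).1 (fun y' => if ¬ Torus.tnorm (csite (ed x).2 - csite₁ (ed₁ y').2) ≤ RN then ‖T x y'‖ else 0)
  simp only [Equiv.apply_symm_apply] at h2
  rw [sum_filter, h2]
  calc ∑ y' ∈ univ.filter (fun y' : Γ₁' => (ed₁ y').1 = (ed x).1),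
          (if ¬ Torus.tnorm (csite (ed x).2 - csite₁ (ed₁ y').2) ≤ RN then ‖T x y'‖ else 0)
        ≤ ∑ y' : Γ₁', (if ¬ Torus.tnorm (csite (ed x).2 - csite₁ (ed₁ y').2) ≤ RN then ‖T x y'‖ else 0) :=
          sum_le_sum_of_subset_of_nonneg (filter_subset _ _) fun _ _ _ => by split_ifs <;> simp
      _ = ∑ y' ∈ univ.filter (fun y' : Γ₁' => ¬ Torus.tnorm (csite (ed x).2 - csite₁ (ed₁ y').2) ≤ RN), ‖T x y'‖ := by rw [sum_filter]
      _ ≤ ∑ y' ∈ univ.filter (fun y' : Γ₁' => RN < Torus.tnorm (site' x - site₁ y')), ‖T x y'‖ := by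
          refine sum_le_sum_of_subset_of_nonneg (fun y' hy => ?_) fun _ _ _ => norm_nonneg _
          simp only [mem_filter, mem_univ, true_and, not_le] at hy ⊢
          rw [hed2, hed₁2] at hy
          exact lt_of_lt_of_le hy (tnorm_residue_sub_le hLf (site' x) (site₁ y'))
      _ ≤ cW / (1 + ΛT * ((RN : ℝ) + 1)) := sum_far_norm_le_of_scaledRow₂ site' site₁ T hΛT RN x (hrow x)
      _ ≤ cW / (1 + ΛT * ((r : ℝ) + 1)) := div_one_add_mul_anti hcW hΛT hrN

/-- `hτ₁T`: at an `R`-deep out-leg `x` and a residue `ȳ` within `RZ` of `x`'s residue, the column of the in-block leg `ed₁⁻¹(block x, ȳ)` over the OTHER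
blocks is `≤ cW/(1 + Λ_T(r+1))` whenever `r + RZ ≤ R` (that leg is `r`-deep, other blocks are `r`-far). [folklore] -/
theorem transfer_tau1_le {Γ' Γ₁' : Type*} [Fintype Γ'] [Fintype Γ₁'] {Lf : ℕ} (site' : Γ' → TorusSite 2 Lf) (site₁ : Γ₁' → TorusSite 2 Lf)
    (T : Matrix Γ' Γ₁' ℂ) {ΛT cW : ℝ} (hΛT : 0 ≤ ΛT)
    (hcol : ∀ y', ∑ x, ‖T x y'‖ * (1 + ΛT * (Torus.tnorm (site' x - site₁ y') : ℝ)) ≤ cW)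
    {b L : ℕ} [NeZero L] [NeZero Lf] [NeZero b] (hLf : Lf = b * L) {Γ Γ₁ : Type*} [Fintype Γ] [Fintype Γ₁]
    (ed : Γ' ≃ (Fin 2 → Fin b) × Γ) (ed₁ : Γ₁' ≃ (Fin 2 → Fin b) × Γ₁)
    (hed1 : ∀ x i, (((ed x).1 i : ℕ)) = (site' x i).val / L) (hed₁1 : ∀ y' i, (((ed₁ y').1 i : ℕ)) = (site₁ y' i).val / L)
    (csite : Γ → TorusSite 2 L) (csite₁ : Γ₁ → TorusSite 2 L)
    (hed2 : ∀ x, csite (ed x).2 = fun i => ((((site' x i).val : ℕ)) : ZMod L)) (hed₁2 : ∀ y', csite₁ (ed₁ y').2 = fun i => ((((site₁ y' i).val : ℕ)) : ZMod L))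
    {r R RZ : ℕ} (hrR : r + RZ ≤ R) (x : Γ') (hx : ∀ j, R ≤ (site' x j).val % L ∧ (site' x j).val % L + R < L)
    (y : Γ₁) (hy : ¬ RZ < Torus.tnorm (csite (ed x).2 - csite₁ y)) :
    ∑ x₂ ∈ univ.filter (fun x₂ : Γ' => (ed x₂).1 ≠ (ed x).1), ‖T x₂ (ed₁.symm ((ed x).1, y))‖ ≤ cW / (1 + ΛT * ((r : ℝ) + 1)) := by
  classical
  set y'' : Γ₁' := ed₁.symm ((ed x).1, y) with hy''
  have hblk : (ed₁ y'').1 = (ed x).1 := by rw [hy'', Equiv.apply_symm_apply]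
  have hres : csite₁ y = fun i => ((((site₁ y'' i).val : ℕ)) : ZMod L) := by
    rw [← hed₁2 y'', hy'', Equiv.apply_symm_apply]
  have hdeep : ∀ j, r ≤ (site₁ y'' j).val % L ∧ (site₁ y'' j).val % L + r < L := by
    refine deep_of_sameBlock_near hrR hx ?_
    rw [← hed2, ← hres]; exact not_lt.1 hy
  have hfar : ∀ x₂ : Γ', (ed x₂).1 ≠ (ed x).1 → r < Torus.tnorm (site' x₂ - site₁ y'') := by
    intro x₂ hne
    rw [← hblk] at hne
    exact far_of_block_ne_of_deep hLf (hed1 x₂) (hed₁1 y'') hne hdeep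
  calc ∑ x₂ ∈ univ.filter (fun x₂ : Γ' => (ed x₂).1 ≠ (ed x).1), ‖T x₂ y''‖
      ≤ ∑ x₂ ∈ univ.filter (fun x₂ : Γ' => r < Torus.tnorm (site' x₂ - site₁ y'')), ‖T x₂ y''‖ :=
        sum_le_sum_of_subset_of_nonneg (fun x₂ hx₂ => by
          simp only [mem_filter, mem_univ, true_and] at hx₂ ⊢; exact hfar x₂ hx₂) fun _ _ _ => norm_nonneg _
    _ ≤ cW / (1 + ΛT * ((r : ℝ) + 1)) := sum_far_norm_le_of_scaledCol₂ site' site₁ T hΛT r y'' (hcol y'')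

/-- `hτ₄T`: under BLOCK COVARIANCE the winding tails ARE the other-block column tails (`…BlockCovariance.sum_blocks_erase_sum_box_eq_colOut`), hence
`≤ cW/(1 + Λ_T(r+1))` as in `transfer_tau1_le`. [folklore] -/
theorem transfer_tau4_le {Γ' Γ₁' : Type*} [Fintype Γ'] [Fintype Γ₁'] {Lf : ℕ} (site' : Γ' → TorusSite 2 Lf) (site₁ : Γ₁' → TorusSite 2 Lf)
    (T : Matrix Γ' Γ₁' ℂ) {ΛT cW : ℝ} (hΛT : 0 ≤ ΛT)
    (hcol : ∀ y', ∑ x, ‖T x y'‖ * (1 + ΛT * (Torus.tnorm (site' x - site₁ y') : ℝ)) ≤ cW)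
    {b L : ℕ} [NeZero L] [NeZero Lf] [NeZero b] (hLf : Lf = b * L) {Γ Γ₁ : Type*} [Fintype Γ] [Fintype Γ₁]
    (ed : Γ' ≃ (Fin 2 → Fin b) × Γ) (ed₁ : Γ₁' ≃ (Fin 2 → Fin b) × Γ₁)
    (hed1 : ∀ x i, (((ed x).1 i : ℕ)) = (site' x i).val / L) (hed₁1 : ∀ y' i, (((ed₁ y').1 i : ℕ)) = (site₁ y' i).val / L)
    (csite : Γ → TorusSite 2 L) (csite₁ : Γ₁ → TorusSite 2 L)
    (hed2 : ∀ x, csite (ed x).2 = fun i => ((((site' x i).val : ℕ)) : ZMod L)) (hed₁2 : ∀ y', csite₁ (ed₁ y').2 = fun i => ((((site₁ y' i).val : ℕ)) : ZMod L))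
    (hcov : ∀ (δ β' β : Fin 2 → Fin b) (xbar : Γ) (y : Γ₁), ‖T (ed.symm (β' + δ, xbar)) (ed₁.symm (β + δ, y))‖ = ‖T (ed.symm (β', xbar)) (ed₁.symm (β, y))‖)
    {r R RZ : ℕ} (hrR : r + RZ ≤ R) (x : Γ') (hx : ∀ j, R ≤ (site' x j).val % L ∧ (site' x j).val % L + R < L)
    (y : Γ₁) (hy : ¬ RZ < Torus.tnorm (csite (ed x).2 - csite₁ y)) :
    ∑ β ∈ univ.erase (ed x).1, ∑ x₂ ∈ univ.filter (fun x₂ : Γ' => (ed x₂).1 = (ed x).1), ‖T x₂ (ed₁.symm (β, y))‖ ≤ cW / (1 + ΛT * ((r : ℝ) + 1)) := by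
  classical
  rw [sum_blocks_erase_sum_box_eq_colOut ed₁ ed (fun x₂ y' => ‖T x₂ y'‖) hcov (ed x).1 y]
  exact transfer_tau1_le site' site₁ T hΛT hcol hLf ed ed₁ hed1 hed₁1 csite csite₁ hed2 hed₁2 hrR x hx y hy

end Transfer

end Summit.HubbardSuperconductivity.HubbardSuperconductivity.Theorems.TwoVolumeDefect

end
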